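import Summits.PneNP.PneNP.Theorems.SzkEntropyPeaThreeNotInPLatticeGapPrep
import HarnessLib

/-!
# Crux `PeaThreeNotInP` (stmt-PneNP-10776), line `SketchIdeator3`, socket client `lattice-cube-smoothing`:
# the entropy gap (`stub_gap`)

The lead's stub of skeleton v6: the instance map `latRed : GapCVPInstance → PEDBPInst` sends
YES-instances of `GapCVP_n` (close: `dist(t, L(B)) ≤ d`) to NO-instances of `PEDBPGap 1 10`
(`H(p) + 1/10 ≤ H(q)`) and NO-instances (far: `dist > n d`) to YES-instances (`H(q) ≤ H(p)`):
dimension `0` ↦ `noI`, dimension `1` decided exactly (`geom_oneDim` vs `oneDimFar`), dimension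
`≥ 2` by the two chains `gap_close` (closest vector, pairing overlap `≥ |Box|/10`,
`mixture_entropy_le`) and `gap_far` (disjoint translates, `mixture_entropy_ge`) on top of
`gap_entropies` (preparations file).

References: O. Goldreich, S. Goldwasser, JCSS 60 (2000) §3; Z. Dvir, D. Gutfreund, G. N. Rothblum,
S. Vadhan, ECCC TR10-160 (2010) §4.4.
-/

namespace Summit.PneNP.PneNP.Cruxes.PeaThreeNotInP.LatticeLine

set_option linter.dupNamespace false -- `Summit.PneNP.PneNP.…`: summit = sub-problem name (D-0017)

open Finset Metric
open Literature.InformationTheory.Entropy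
open Literature.Computability.Complexity Literature.Algebra.EuclideanLattices
open Summit.PneNP.PneNP.Cruxes.PeaThreeNotInP.SocketBP (PEDBPGap encode_mem_PEDBPGap_yes_iff
  encode_mem_PEDBPGap_no_iff mixture_entropy_le)
open Summit.PneNP.PneNP.Cruxes.PeaThreeNotInP.TensorIsoLine (mixture_entropy_ge)

section Generic

variable (n : ℕ) (B : Matrix (Fin n) (Fin n) ℤ) (t : Fin n → ℤ) (d : ℚ)

/-- **Close ⇒ `H(p) + 1/10 ≤ H(q)`** (dimension `n ≥ 2`): a closest vector gives the pairing
`(z, e) ↦ (z + z₀, e + w)` between the two translates with overlap `≥ |Box| / 10`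
(`geom_close`, `stub_overlap`), and `mixture_entropy_le`. [cite: GoldreichGoldwasser2000, §3] -/
theorem gap_close (c : CVPTup) (hc : c = GapCodes.cvpTup ((⟨⟨n, B⟩, t⟩ : CVPInstance), d))
    (hn : 2 ≤ n) (hB : B.det ≠ 0) (hd : 0 < d)
    (hclose : infDist (intVecToEuclidean n t) (LatticeInstance.lattice ⟨n, B⟩ : Set (EuclideanSpace ℝ (Fin n))) ≤ d) :
    bpEntropy c.N c.progsP + 1 / 10 ≤ bpEntropy c.N c.progsQ := by
  obtain ⟨hP, hQ, hFG, ⟨hK1, hM, hKlo, hKhi, hℓ, hentry, htgt⟩, hcn, hnum, hden, hBc, htc⟩ :=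
    gap_entropies n B t d c hc hn hd
  -- real numbers
  have ha : (c.a : ℤ) = d.num := by rw [hc]; exact Int.toNat_of_nonneg (Rat.num_pos.2 hd).le
  have hdQ : (d : ℝ) = (c.a : ℝ) / (c.den : ℝ) := by
    have h1 : (d : ℝ) = (d.num : ℝ) / (d.den : ℝ) := by exact_mod_cast (Rat.num_div_den d).symm
    have h2 : ((c.a : ℤ) : ℝ) = (d.num : ℝ) := by exact_mod_cast ha
    have h3 : (c.den : ℝ) = (d.den : ℝ) := by rw [hc]; rfl
    rw [h1, ← h2, h3]
    rfl
  have hnR : (2 : ℝ) ≤ n := by exact_mod_cast hn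
  have hs : (7 / 5 : ℝ) ≤ Real.sqrt n := by
    rw [Real.le_sqrt (by norm_num) (by linarith)]
    nlinarith
  have hsn : Real.sqrt n ≤ n := by
    rw [Real.sqrt_le_left (by linarith)]
    nlinarith
  have hMR : (64 : ℝ) * n * c.a < c.M := by
    have := hM; rw [hcn] at this; exact_mod_cast this
  have hM1 : (1 : ℝ) ≤ c.M := by exact_mod_cast (Nat.one_le_two_pow : 1 ≤ c.M)
  rw [hcn] at hKlo hKhi
  obtain ⟨-, hKd, hsKd⟩ := gap_arith (c.M : ℝ) c.a c.den c.K (Real.sqrt n) n hs hsn hnR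
    (Nat.cast_nonneg _) (by exact_mod_cast hden) hM1 hMR hKlo hKhi
  rw [← hdQ] at hKd hsKd
  -- the closest vector
  have hMS : ∀ i j, (B i j).natAbs ≤ c.S₀ := fun i j => by rw [← hBc i j]; exact hentry i j
  have htS : ∀ i, ((t i).natAbs : ℝ) + d ≤ c.S₀ := by
    intro i
    have h1 : (c.tgt i).natAbs + c.a ≤ c.S₀ := htgt i
    rw [htc i] at h1
    have h2 : ((t i).natAbs : ℝ) + c.a ≤ c.S₀ := by exact_mod_cast h1
    have hda : (d : ℝ) ≤ c.a := by
      rw [hdQ]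
      exact div_le_self (Nat.cast_nonneg _) (by exact_mod_cast hden)
    linarith
  obtain ⟨z₀, w, hdec, hnorm, hz₀⟩ := geom_close n B t d (c.K : ℤ) c.S₀ hB hclose hMS htS
  have hz : ∀ i, 32 * n * (z₀ i).natAbs ≤ 2 ^ c.ℓ := fun i => by
    have h := hℓ
    rw [hcn] at h
    exact (Nat.mul_le_mul_left _ (hz₀ i)).trans h
  have hKd0 : (0 : ℝ) ≤ (c.K : ℝ) * d := by
    have : (0 : ℝ) < d := by exact_mod_cast hd
    positivity
  have habs : ∀ i, ((w i).natAbs : ℝ) = |(w i : ℝ)| := fun i => by rw [Nat.cast_natAbs, Int.cast_abs]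
  have hwi : ∀ i, |(w i : ℝ)| ≤ (c.K : ℝ) * d := by
    intro i
    refine abs_le_of_sq_le_sq ?_ hKd0
    calc (w i : ℝ) ^ 2 ≤ ∑ j, (w j : ℝ) ^ 2 :=
          Finset.single_le_sum (fun j _ => sq_nonneg ((w j : ℝ))) (Finset.mem_univ i)
      _ ≤ ((c.K : ℝ) * d) ^ 2 := hnorm
  have hw : ∀ i, 4 * (w i).natAbs ≤ 3 * 2 ^ c.m := by
    intro i
    have h1 : (4 : ℝ) * |(w i : ℝ)| ≤ 3 * c.M := by linarith [hwi i, hKd]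
    have h3 : ((4 * (w i).natAbs : ℕ) : ℝ) ≤ ((3 * 2 ^ c.m : ℕ) : ℝ) := by
      push_cast
      rw [habs i]
      have : ((2 : ℝ) ^ c.m) = (c.M : ℝ) := by
        rw [show c.M = 2 ^ c.m from rfl]; push_cast; rfl
      rw [this]
      exact h1
    exact_mod_cast h3
  have hws : 32 * ∑ i, (w i).natAbs ≤ 33 * 2 ^ c.m := by
    have h1 : (∑ i, |(w i : ℝ)|) ^ 2 ≤ n * ∑ i, (w i : ℝ) ^ 2 := gap_sum_abs_sq_le _
    have hn0 : (0 : ℝ) ≤ n := by linarith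
    have h2 : (∑ i, |(w i : ℝ)|) ^ 2 ≤ (Real.sqrt n * ((c.K : ℝ) * d)) ^ 2 := by
      rw [mul_pow, Real.sq_sqrt hn0]
      exact h1.trans (mul_le_mul_of_nonneg_left hnorm hn0)
    have h3 : ∑ i, |(w i : ℝ)| ≤ Real.sqrt n * ((c.K : ℝ) * d) := by
      have := abs_le_of_sq_le_sq h2 (by positivity)
      rwa [abs_of_nonneg (Finset.sum_nonneg fun i _ => abs_nonneg _)] at this
    have h6 : (32 : ℝ) * ∑ i, |(w i : ℝ)| ≤ 33 * c.M := by linarith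
    have h7 : ((32 * ∑ i, (w i).natAbs : ℕ) : ℝ) ≤ ((33 * 2 ^ c.m : ℕ) : ℝ) := by
      push_cast
      simp only [habs]
      have : ((2 : ℝ) ^ c.m) = (c.M : ℝ) := by
        rw [show c.M = 2 ^ c.m from rfl]; push_cast; rfl
      rw [this]
      exact h6
    exact_mod_cast h7
  have hover := stub_overlap n c.ℓ c.m (c.K : ℤ) B t z₀ w hdec hz hw hws
  haveI : Nonempty (Box n c.ℓ c.m) :=
    ⟨(fun _ => ⟨0, Nat.two_pow_pos _⟩, fun _ => ⟨0, Nat.two_pow_pos _⟩)⟩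
  have hle := mixture_entropy_le (sampF n (c.K : ℤ) B t : Box n c.ℓ c.m → Fin n → ℤ)
    (sampG n (c.K : ℤ) B)
  have hcard : (0 : ℝ) < Fintype.card (Box n c.ℓ c.m) := by exact_mod_cast Fintype.card_pos
  have hfrac : (1 : ℝ) / 10 ≤ (∑ y ∈ (Finset.univ : Finset (Box n c.ℓ c.m)).image (sampF n (c.K : ℤ) B t),
      (min (Finset.univ.filter fun ze : Box n c.ℓ c.m => sampF n (c.K : ℤ) B t ze = y).card
        (Finset.univ.filter fun ze : Box n c.ℓ c.m => sampG n (c.K : ℤ) B ze = y).card : ℝ)) /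
        Fintype.card (Box n c.ℓ c.m) := by
    rw [div_le_div_iff₀ (by norm_num) hcard]
    linarith
  rw [hP, hQ]
  linarith [hle, hfrac, hFG]

/-- **Far ⇒ `H(q) ≤ H(p)`** (dimension `n ≥ 2`): the two translates have disjoint images
(`geom_far`), so the mixture gains a full bit (`mixture_entropy_ge`). [cite: GoldreichGoldwasser2000, §3] -/
theorem gap_far (c : CVPTup) (hc : c = GapCodes.cvpTup ((⟨⟨n, B⟩, t⟩ : CVPInstance), d))
    (hn : 2 ≤ n) (hd : 0 < d)
    (hfar : (n : ℝ) * d < infDist (intVecToEuclidean n t) (LatticeInstance.lattice ⟨n, B⟩ : Set (EuclideanSpace ℝ (Fin n)))) :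
    bpEntropy c.N c.progsQ ≤ bpEntropy c.N c.progsP := by
  obtain ⟨hP, hQ, hFG, ⟨hK1, hM, hKlo, hKhi, -, -, -⟩, hcn, -, hden, -, -⟩ :=
    gap_entropies n B t d c hc hn hd
  have ha : (c.a : ℤ) = d.num := by rw [hc]; exact Int.toNat_of_nonneg (Rat.num_pos.2 hd).le
  have hdQ : (d : ℝ) = (c.a : ℝ) / (c.den : ℝ) := by
    have h1 : (d : ℝ) = (d.num : ℝ) / (d.den : ℝ) := by exact_mod_cast (Rat.num_div_den d).symm
    have h2 : ((c.a : ℤ) : ℝ) = (d.num : ℝ) := by exact_mod_cast ha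
    have h3 : (c.den : ℝ) = (d.den : ℝ) := by rw [hc]; rfl
    rw [h1, ← h2, h3]
    rfl
  have hnR : (2 : ℝ) ≤ n := by exact_mod_cast hn
  have hs : (7 / 5 : ℝ) ≤ Real.sqrt n := by
    rw [Real.le_sqrt (by norm_num) (by linarith)]
    nlinarith
  have hsn : Real.sqrt n ≤ n := by
    rw [Real.sqrt_le_left (by linarith)]
    nlinarith
  have hMR : (64 : ℝ) * n * c.a < c.M := by
    have := hM; rw [hcn] at this; exact_mod_cast this
  have hM1 : (1 : ℝ) ≤ c.M := by exact_mod_cast (Nat.one_le_two_pow : 1 ≤ c.M)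
  rw [hcn] at hKlo hKhi
  obtain ⟨hlo, -, -⟩ := gap_arith (c.M : ℝ) c.a c.den c.K (Real.sqrt n) n hs hsn hnR
    (Nat.cast_nonneg _) (by exact_mod_cast hden) hM1 hMR hKlo hKhi
  rw [← hdQ] at hlo
  have hK0 : (0 : ℤ) < (c.K : ℤ) := by exact_mod_cast hK1
  have hKM : ((2 ^ c.m : ℕ) : ℝ) - 1 ≤ Real.sqrt n * ((c.K : ℤ) : ℝ) * d := by
    have e1 : ((2 ^ c.m : ℕ) : ℝ) = (c.M : ℝ) := by rw [show c.M = 2 ^ c.m from rfl]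
    have e2 : (((c.K : ℤ)) : ℝ) = (c.K : ℝ) := by norm_cast
    rw [e1, e2]
    exact hlo
  have hdisj := geom_far n B t d (c.K : ℤ) c.ℓ c.m hK0 hKM hfar
  haveI : Nonempty (Box n c.ℓ c.m) :=
    ⟨(fun _ => ⟨0, Nat.two_pow_pos _⟩, fun _ => ⟨0, Nat.two_pow_pos _⟩)⟩
  classical
  have hge := mixture_entropy_ge (sampF n (c.K : ℤ) B t : Box n c.ℓ c.m → Fin n → ℤ)
    (sampG n (c.K : ℤ) B) Set.univ 1 (by simp) (by simp) (fun i j _ _ => hdisj i j)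
  rw [hP, hQ]
  linarith [hge, hFG]

end Generic

/-! ### The stub -/

/-- **The entropy gap of the lattice client** (the lead's stub of skeleton v6): YES-instances of
`GapCVP_n` are sent to NO-instances of `PEDBPGap 1 10`, NO-instances to YES-instances.
[cite: GoldreichGoldwasser2000, §3; DvirGutfreundRothblumVadhan2010, §4.4] -/
theorem stub_gap : (∀ p ∈ GapCVP.yes (fun n => (n : ℝ)), PEDBPInst.encoding.encode (latRed p) ∈ (PEDBPGap 1 10).no) ∧ (∀ p ∈ GapCVP.no (fun n => (n : ℝ)), PEDBPInst.encoding.encode (latRed p) ∈ (PEDBPGap 1 10).yes) := by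
  constructor
  · rintro ⟨⟨⟨n, B⟩, t⟩, d⟩ ⟨hB, hd, hdist⟩
    change B.det ≠ 0 at hB
    change infDist (intVecToEuclidean n t) (LatticeInstance.lattice ⟨n, B⟩ : Set (EuclideanSpace ℝ (Fin n)))
      ≤ (d : ℝ) at hdist
    rcases n with _ | _ | n
    · -- dimension 0: the image is `noI`
      exact encode_noI_mem_no
    · -- dimension 1: exact decision, close ⇒ `noI`
      have hg : B 0 0 ≠ 0 := by rwa [Matrix.det_fin_one] at hB
      have hD := geom_oneDim B t hg
      have hfalse : oneDimFar (B 0 0) (t 0) d.num d.den = false := by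
        unfold oneDimFar
        rw [decide_eq_false_iff_not, ← gap_rat_lt_int_iff, not_lt, ← hD]
        exact hdist
      have e0 : CVPTup.entry (GapCodes.cvpTup ((⟨⟨1, B⟩, t⟩ : CVPInstance), d)) 0 0 = B 0 0 := by
        simpa using tup_entry B t d 0 0
      have e1 : CVPTup.tgt (GapCodes.cvpTup ((⟨⟨1, B⟩, t⟩ : CVPInstance), d)) 0 = t 0 := by
        simpa using tup_tgt B t d 0
      have himg : latRed ((⟨⟨1, B⟩, t⟩ : CVPInstance), d) = noI := by
        show latRedTup _ = noI
        unfold latRedTup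
        rw [show CVPTup.n (GapCodes.cvpTup ((⟨⟨1, B⟩, t⟩ : CVPInstance), d)) = 1 from rfl,
          if_neg (show ¬ ((1 : ℕ) = 0) by decide), if_pos (show (1 : ℕ) = 1 from rfl)]
        rw [show CVPTup.num (GapCodes.cvpTup ((⟨⟨1, B⟩, t⟩ : CVPInstance), d)) = d.num from rfl,
          show CVPTup.den (GapCodes.cvpTup ((⟨⟨1, B⟩, t⟩ : CVPInstance), d)) = d.den from rfl]
        rw [e0, e1, hfalse]
        rfl
      rw [himg]
      exact encode_noI_mem_no
    · -- dimension ≥ 2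
      have himg : latRed ((⟨⟨n + 2, B⟩, t⟩ : CVPInstance), d) =
          CVPTup.generic (GapCodes.cvpTup ((⟨⟨n + 2, B⟩, t⟩ : CVPInstance), d)) := by
        show latRedTup _ = _
        unfold latRedTup
        rw [show CVPTup.n (GapCodes.cvpTup ((⟨⟨n + 2, B⟩, t⟩ : CVPInstance), d)) = n + 2 from rfl,
          if_neg (show ¬ (n + 2 = 0) by omega), if_neg (show ¬ (n + 2 = 1) by omega)]
      rw [himg, encode_mem_PEDBPGap_no_iff]
      have h := gap_close (n + 2) B t d _ rfl (by omega) hB hd hdist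
      push_cast
      exact h
  · rintro ⟨⟨⟨n, B⟩, t⟩, d⟩ ⟨hB, hd, hdist⟩
    change B.det ≠ 0 at hB
    change ((n : ℕ) : ℝ) * (d : ℝ) <
      infDist (intVecToEuclidean n t) (LatticeInstance.lattice ⟨n, B⟩ : Set (EuclideanSpace ℝ (Fin n))) at hdist
    rcases n with _ | _ | n
    · -- dimension 0: no far instance (`t ∈ L`)
      exfalso
      have ht : intVecToEuclidean 0 t ∈ (LatticeInstance.lattice ⟨0, B⟩ : Set (EuclideanSpace ℝ (Fin 0))) := by
        have : intVecToEuclidean 0 t = 0 := Subsingleton.elim _ _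
        rw [this]
        exact Submodule.zero_mem _
      have h0 := Metric.infDist_zero_of_mem ht
      rw [h0] at hdist
      simp at hdist
    · -- dimension 1: exact decision, far ⇒ `yesI`
      have hg : B 0 0 ≠ 0 := by rwa [Matrix.det_fin_one] at hB
      have hD := geom_oneDim B t hg
      have htrue : oneDimFar (B 0 0) (t 0) d.num d.den = true := by
        unfold oneDimFar
        rw [decide_eq_true_iff, ← gap_rat_lt_int_iff, ← hD]
        simpa using hdist
      have e0 : CVPTup.entry (GapCodes.cvpTup ((⟨⟨1, B⟩, t⟩ : CVPInstance), d)) 0 0 = B 0 0 := by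
        simpa using tup_entry B t d 0 0
      have e1 : CVPTup.tgt (GapCodes.cvpTup ((⟨⟨1, B⟩, t⟩ : CVPInstance), d)) 0 = t 0 := by
        simpa using tup_tgt B t d 0
      have himg : latRed ((⟨⟨1, B⟩, t⟩ : CVPInstance), d) = yesI := by
        show latRedTup _ = yesI
        unfold latRedTup
        rw [show CVPTup.n (GapCodes.cvpTup ((⟨⟨1, B⟩, t⟩ : CVPInstance), d)) = 1 from rfl,
          if_neg (show ¬ ((1 : ℕ) = 0) by decide), if_pos (show (1 : ℕ) = 1 from rfl)]
        rw [show CVPTup.num (GapCodes.cvpTup ((⟨⟨1, B⟩, t⟩ : CVPInstance), d)) = d.num from rfl,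
          show CVPTup.den (GapCodes.cvpTup ((⟨⟨1, B⟩, t⟩ : CVPInstance), d)) = d.den from rfl]
        rw [e0, e1, htrue]
        rfl
      rw [himg]
      exact encode_yesI_mem_yes
    · -- dimension ≥ 2
      have himg : latRed ((⟨⟨n + 2, B⟩, t⟩ : CVPInstance), d) =
          CVPTup.generic (GapCodes.cvpTup ((⟨⟨n + 2, B⟩, t⟩ : CVPInstance), d)) := by
        show latRedTup _ = _
        unfold latRedTup
        rw [show CVPTup.n (GapCodes.cvpTup ((⟨⟨n + 2, B⟩, t⟩ : CVPInstance), d)) = n + 2 from rfl,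
          if_neg (show ¬ (n + 2 = 0) by omega), if_neg (show ¬ (n + 2 = 1) by omega)]
      rw [himg, encode_mem_PEDBPGap_yes_iff]
      have hdist' : ((n + 2 : ℕ) : ℝ) * d <
          infDist (intVecToEuclidean (n + 2) t) (LatticeInstance.lattice ⟨n + 2, B⟩ : Set _) := hdist
      exact gap_far (n + 2) B t d _ rfl (by omega) hd hdist'

end Summit.PneNP.PneNP.Cruxes.PeaThreeNotInP.LatticeLine
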